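import Summits.BirchSwinnertonDyer.Rank1Residual.AdditivePotMult.QuadraticTwistTamagawaTypeIVPlace
import HarnessLib

/-!
# Uniformisers, the `v(Δ) < 12` criterion and the discriminant of a type-`IV` / `IV*` normal form

Row **T-MIL-B, stage B-3, local half** (n1011-p08 GEN 3): the place-level lemmas behind the INERT
entry of Milne's per-place identity (T) at additive places of Kodaira type `IV` / `IV*`
(sibling file `QuadraticBaseChangeTamagawaTypeIVInert`).

* §1 At a finite place `v` of a Dedekind domain, an element of the complete DVR `𝒪_v` is
  irreducible iff its valuation is `exp (-1)`; an integral Weierstrass equation over `K_v` with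
  `exp (-12) < v(Δ)` is minimal (Silverman *AEC* VII.1 Remark 1.1; the place form of the tree's
  `isMinimal_of_exp_neg_twelve_lt_valued_Δ` over `ℚ`).
* §2 Over any DVR: the discriminant of a type-`IV` normal form (`a₁, a₂ ∈ 𝔪`, `a₃ = ϖγ`, `a₄ ∈ 𝔪²`,
  `a₆ = ϖ²ε`) is `ϖ⁴ · (-27(γ² + 4ε)² + ϖQ)`, of a type-`IV*` normal form `ϖ⁸ · (-27(γ² + 4ε)² + ϖQ)`
  (`ring` identities on the `b₂, b₄, b₆, b₈`), and the cofactor is a unit when `3` is a unit and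
  `γ̄² + 4ε̄ ≠ 0`.
* §3 Hence `exp (-12) < v(Δ)` (`v(Δ) = exp (-4)`, resp. `exp (-8)`) for these normal forms at `v ∤ 3`.

HONEST FRAMING: TOOL lemmas; nothing booked; no mark moved; no new definition, no named fact.
References: Silverman *ATAEC* IV.9.4 Steps 5, 8 and Table 4.1 (`v(Δ) = 4, 8` at `IV`, `IV*` away
from `2, 3`); Silverman *AEC* VII.1 Remark 1.1.
-/

noncomputable section

open scoped Classical NumberField
open WeierstrassCurve NumberField IsDedekindDomain IsLocalRing Polynomial Rat.HeightOneSpectrum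
  Literature.NumberTheory.DiophantineGeometry.TateAlgorithm
  Literature.NumberTheory.EllipticCurves Literature.NumberTheory.EllipticCurves.LocalIndex
  Summit.BirchSwinnertonDyer.Rank1Residual.Additive

namespace Summit.BirchSwinnertonDyer.Rank1Residual.AdditivePotMult

namespace TypeIVTwist

/-! ## §1 Irreducibles of `𝒪_v` are the elements of valuation `exp (-1)` -/

section Valuation

variable {A : Type*} [CommRing A] [IsDedekindDomain A] {K : Type*} [Field K] [Algebra A K]
  [IsFractionRing A K] (v : HeightOneSpectrum A)

/-- `exp (-1)` is a value of `Valued.v` on `K_v` (Mathlib `valuation_exists_uniformizer`). [folklore] -/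
theorem exists_valued_eq_exp_neg_one :
    ∃ π : v.adicCompletionIntegers K, Valued.v (π : v.adicCompletion K) = WithZero.exp (-1 : ℤ) := by
  obtain ⟨x, hx⟩ := v.valuation_exists_uniformizer K
  have hx' : Valued.v ((x : K) : v.adicCompletion K) = WithZero.exp (-1 : ℤ) := by
    rw [HeightOneSpectrum.valuedAdicCompletion_eq_valuation', hx]
  refine ⟨⟨(x : v.adicCompletion K), ?_⟩, hx'⟩
  rw [HeightOneSpectrum.mem_adicCompletionIntegers, hx', ← WithZero.exp_zero, WithZero.exp_le_exp]
  norm_num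

/-- `exp (-1) ≠ 1` in `ℤᵐ⁰`. [folklore] -/
private theorem exp_neg_one_ne_one : WithZero.exp (-1 : ℤ) ≠ (1 : WithZero (Multiplicative ℤ)) :=
  ((WithZero.exp_lt_exp.mpr (by norm_num)).trans_eq WithZero.exp_zero).ne

/-- A non-unit of `𝒪_v` has valuation `≤ exp (-1)`. [folklore] -/
theorem valued_le_exp_neg_one_of_not_isUnit {x : v.adicCompletionIntegers K} (hx : ¬ IsUnit x) :
    Valued.v (x : v.adicCompletion K) ≤ WithZero.exp (-1 : ℤ) := by
  rw [HeightOneSpectrum.adicCompletionIntegers.isUnit_iff_valued_eq_one] at hx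
  have hle : Valued.v (x : v.adicCompletion K) ≤ 1 := x.2
  rcases eq_or_ne (Valued.v (x : v.adicCompletion K)) 0 with h0 | h0
  · rw [h0]; exact zero_le
  · rw [← WithZero.exp_log h0] at hx hle ⊢
    rw [← WithZero.exp_zero, WithZero.exp_le_exp] at hle
    have hm0 : WithZero.log (Valued.v (x : v.adicCompletion K)) ≠ 0 := fun h ↦
      hx (by rw [h, WithZero.exp_zero])
    rw [WithZero.exp_le_exp]
    omega

/-- **An element of `𝒪_v` is irreducible iff its valuation is `exp (-1)`** (the uniformisers of the
complete DVR `𝒪_v`). [folklore] -/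
theorem irreducible_iff_valued_eq_exp_neg_one (x : v.adicCompletionIntegers K) :
    Irreducible x ↔ Valued.v (x : v.adicCompletion K) = WithZero.exp (-1 : ℤ) := by
  constructor
  · intro hx
    obtain ⟨π, hπ⟩ := exists_valued_eq_exp_neg_one (K := K) v
    have hπu : ¬ IsUnit π := by
      rw [HeightOneSpectrum.adicCompletionIntegers.isUnit_iff_valued_eq_one, hπ]
      exact exp_neg_one_ne_one
    have hπmem : π ∈ maximalIdeal (v.adicCompletionIntegers K) := hπu
    rw [(IsDiscreteValuationRing.irreducible_iff_uniformizer x).mp hx, Ideal.mem_span_singleton] at hπmem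
    obtain ⟨t, ht⟩ := hπmem
    have hxle := valued_le_exp_neg_one_of_not_isUnit (K := K) v hx.not_isUnit
    have htle : Valued.v (t : v.adicCompletion K) ≤ 1 := t.2
    refine le_antisymm hxle ?_
    have hmul : Valued.v (x : v.adicCompletion K) * Valued.v (t : v.adicCompletion K) =
        WithZero.exp (-1 : ℤ) := by
      rw [← Valuation.map_mul, ← Subring.coe_mul, ← ht, hπ]
    calc WithZero.exp (-1 : ℤ) = Valued.v (x : v.adicCompletion K) * Valued.v (t : v.adicCompletion K) :=
          hmul.symm
      _ ≤ Valued.v (x : v.adicCompletion K) * 1 := by gcongr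
      _ = Valued.v (x : v.adicCompletion K) := mul_one _
  · intro hx
    have hxu : ¬ IsUnit x := by
      rw [HeightOneSpectrum.adicCompletionIntegers.isUnit_iff_valued_eq_one, hx]
      exact exp_neg_one_ne_one
    refine ⟨hxu, fun a b hab ↦ ?_⟩
    by_contra h
    push Not at h
    obtain ⟨ha, hb⟩ := h
    have hale := valued_le_exp_neg_one_of_not_isUnit (K := K) v ha
    have hble := valued_le_exp_neg_one_of_not_isUnit (K := K) v hb
    have hmul : Valued.v (x : v.adicCompletion K) =
        Valued.v (a : v.adicCompletion K) * Valued.v (b : v.adicCompletion K) := by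
      rw [← Valuation.map_mul, ← Subring.coe_mul, ← hab]
    have hle : Valued.v (x : v.adicCompletion K) ≤ WithZero.exp (-1 : ℤ) * WithZero.exp (-1 : ℤ) := by
      rw [hmul]; exact mul_le_mul' hale hble
    rw [hx, ← WithZero.exp_add, WithZero.exp_le_exp] at hle
    norm_num at hle

/-- The valuation of an irreducible element of `𝒪_v` is `exp (-1)`. [folklore] -/
theorem valued_eq_exp_neg_one_of_irreducible {ϖ : v.adicCompletionIntegers K} (hϖ : Irreducible ϖ) :
    Valued.v (ϖ : v.adicCompletion K) = WithZero.exp (-1 : ℤ) :=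
  (irreducible_iff_valued_eq_exp_neg_one v ϖ).mp hϖ

/-- **An integral equation with `v(Δ) < 12` is minimal** at any finite place of a Dedekind domain
(Silverman *AEC* VII.1 Remark 1.1; the place-`v` form of the tree's
`isMinimal_of_exp_neg_twelve_lt_valued_Δ` over `ℚ` / `isMinimal_of_exp_lt_valuation_Δ` over a DVR).
[cite: SilvermanAEC2009, VII.1 Remark 1.1] -/
theorem isMinimal_of_exp_neg_twelve_lt_valued_Δ_place (Y : WeierstrassCurve (v.adicCompletion K))
    [Y.IsIntegral (v.adicCompletionIntegers K)]
    (h : WithZero.exp (-12 : ℤ) < Valued.v Y.Δ) : Y.IsMinimal (v.adicCompletionIntegers K) := by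
  have hV1 := valued_le_one_iff_mem_range_adicCompletionIntegers (K := K) v
  rw [isMinimal_iff_of_le_one_iff hV1]
  refine ⟨inferInstance, fun C hC ↦ ?_⟩
  haveI := hC
  have hint : Valued.v (C • Y).Δ ≤ 1 :=
    (hV1 _).mpr ⟨_, integralModel_Δ_eq (v.adicCompletionIntegers K) (C • Y)⟩
  rw [variableChange_Δ, Valuation.map_mul, Valuation.map_pow] at hint ⊢
  set a := Valued.v (↑C.u⁻¹ : v.adicCompletion K) with ha
  set d := Valued.v Y.Δ with hd
  have ha0 : a ≠ 0 := (Valuation.ne_zero_iff _).mpr (Units.ne_zero _)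
  have hd0 : d ≠ 0 := (WithZero.exp_pos.trans h).ne'
  have had0 : a ^ 12 * d ≠ 0 := mul_ne_zero (pow_ne_zero _ ha0) hd0
  have h1 : -12 < WithZero.log d := WithZero.lt_log_of_exp_lt h
  have h2 : 12 • WithZero.log a + WithZero.log d ≤ 0 := by
    rw [← WithZero.log_pow, ← WithZero.log_mul (pow_ne_zero _ ha0) hd0, ← WithZero.log_one]
    exact (WithZero.log_le_log had0 one_ne_zero).mpr hint
  refine (WithZero.log_le_log had0 hd0).mp ?_
  rw [WithZero.log_mul (pow_ne_zero _ ha0) hd0, WithZero.log_pow]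
  simp only [nsmul_eq_mul, Nat.cast_ofNat] at h2 ⊢
  omega

end Valuation

/-! ## §2 The discriminant of a type-`IV` / `IV*` normal form: `Δ = ϖ⁴ · unit` / `ϖ⁸ · unit` (`ℓ ≠ 3`) -/

section Discriminant

variable {R : Type*} [CommRing R] [IsDomain R] [IsDiscreteValuationRing R]

/-- Membership in `𝔪ⁿ` of a DVR is divisibility by `ϖⁿ` for any irreducible `ϖ`. [folklore] -/
theorem exists_eq_pow_mul_of_mem_maximalIdeal_pow {ϖ : R} (hϖ : Irreducible ϖ) {x : R} {n : ℕ}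
    (hx : x ∈ maximalIdeal R ^ n) : ∃ y : R, x = ϖ ^ n * y := by
  rw [(IsDiscreteValuationRing.irreducible_iff_uniformizer ϖ).mp hϖ, Ideal.span_singleton_pow,
    Ideal.mem_span_singleton] at hx
  exact hx

/-- **`Δ(J) = ϖ⁴ · P` with `P ≡ -27 (γ² + 4ε)² (mod ϖ)` for a type-`IV` normal form**
(`a₁, a₂ ∈ 𝔪`, `a₃ = ϖγ`, `a₄ ∈ 𝔪²`, `a₆ = ϖ²ε`): the `b`-invariants are `b₂ = ϖB₂`, `b₄ = ϖ²B₄`,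
`b₆ = ϖ²(γ² + 4ε)`, `b₈ = ϖ³B₈`, and `Δ = -b₂²b₈ - 8b₄³ - 27b₆² + 9b₂b₄b₆`.
[cite: SilvermanATAEC1994, IV.9.4 Step 5 (PDF p. 344)] -/
theorem exists_Δ_eq_pow_four_mul_of_normalForm_IV (J : WeierstrassCurve R) (h1 : J.a₁ ∈ maximalIdeal R)
    (h2 : J.a₂ ∈ maximalIdeal R) {ϖ γ ε : R} (hϖ : Irreducible ϖ) (hγ : J.a₃ = ϖ * γ)
    (h4 : J.a₄ ∈ maximalIdeal R ^ 2) (hε : J.a₆ = ϖ ^ 2 * ε) :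
    ∃ Q : R, J.Δ = ϖ ^ 4 * (-27 * (γ ^ 2 + 4 * ε) ^ 2 + ϖ * Q) := by
  obtain ⟨α₁, hα₁⟩ := exists_eq_pow_mul_of_mem_maximalIdeal_pow hϖ (x := J.a₁) (n := 1)
    (by rwa [pow_one])
  obtain ⟨α₂, hα₂⟩ := exists_eq_pow_mul_of_mem_maximalIdeal_pow hϖ (x := J.a₂) (n := 1)
    (by rwa [pow_one])
  obtain ⟨α₄, hα₄⟩ := exists_eq_pow_mul_of_mem_maximalIdeal_pow hϖ h4
  rw [pow_one] at hα₁ hα₂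
  refine ⟨-(ϖ * α₁ ^ 2 + 4 * α₂) ^ 2 *
      (ϖ * α₁ ^ 2 * ε + 4 * α₂ * ε - ϖ * α₁ * γ * α₄ + α₂ * γ ^ 2 - ϖ * α₄ ^ 2) -
      8 * ϖ * (2 * α₄ + α₁ * γ) ^ 3 +
      9 * (ϖ * α₁ ^ 2 + 4 * α₂) * (2 * α₄ + α₁ * γ) * (γ ^ 2 + 4 * ε), ?_⟩
  simp only [WeierstrassCurve.Δ, WeierstrassCurve.b₂, WeierstrassCurve.b₄, WeierstrassCurve.b₆,
    WeierstrassCurve.b₈, hα₁, hα₂, hγ, hα₄, hε]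
  ring

/-- **`Δ(J) = ϖ⁸ · P` with `P ≡ -27 (γ² + 4ε)² (mod ϖ)` for a type-`IV*` normal form**
(`a₁ ∈ 𝔪`, `a₂ ∈ 𝔪²`, `a₃ = ϖ²γ`, `a₄ ∈ 𝔪³`, `a₆ = ϖ⁴ε`).
[cite: SilvermanATAEC1994, IV.9.4 Step 8 (PDF p. 346)] -/
theorem exists_Δ_eq_pow_eight_mul_of_normalForm_IVstar (J : WeierstrassCurve R)
    (h1 : J.a₁ ∈ maximalIdeal R) (h2 : J.a₂ ∈ maximalIdeal R ^ 2) {ϖ γ ε : R} (hϖ : Irreducible ϖ)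
    (hγ : J.a₃ = ϖ ^ 2 * γ) (h4 : J.a₄ ∈ maximalIdeal R ^ 3) (hε : J.a₆ = ϖ ^ 4 * ε) :
    ∃ Q : R, J.Δ = ϖ ^ 8 * (-27 * (γ ^ 2 + 4 * ε) ^ 2 + ϖ * Q) := by
  obtain ⟨α₁, hα₁⟩ := exists_eq_pow_mul_of_mem_maximalIdeal_pow hϖ (x := J.a₁) (n := 1)
    (by rwa [pow_one])
  obtain ⟨α₂, hα₂⟩ := exists_eq_pow_mul_of_mem_maximalIdeal_pow hϖ h2
  obtain ⟨α₄, hα₄⟩ := exists_eq_pow_mul_of_mem_maximalIdeal_pow hϖ h4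
  rw [pow_one] at hα₁
  refine ⟨-ϖ * (α₁ ^ 2 + 4 * α₂) ^ 2 *
      (α₁ ^ 2 * ε + 4 * α₂ * ε - α₁ * γ * α₄ + α₂ * γ ^ 2 - α₄ ^ 2) -
      8 * (2 * α₄ + α₁ * γ) ^ 3 +
      9 * (α₁ ^ 2 + 4 * α₂) * (2 * α₄ + α₁ * γ) * (γ ^ 2 + 4 * ε), ?_⟩
  simp only [WeierstrassCurve.Δ, WeierstrassCurve.b₂, WeierstrassCurve.b₄, WeierstrassCurve.b₆,
    WeierstrassCurve.b₈, hα₁, hα₂, hγ, hα₄, hε]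
  ring

/-- The cofactor `-27(γ² + 4ε)² + ϖQ` is a unit when `3` is a unit and `γ̄² + 4ε̄ ≠ 0`. [folklore] -/
theorem isUnit_discCofactor {ϖ γ ε : R} (hϖ : Irreducible ϖ) (h3 : IsUnit (3 : R))
    (hdisc : residue R γ ^ 2 + 4 * residue R ε ≠ 0) (Q : R) :
    IsUnit (-27 * (γ ^ 2 + 4 * ε) ^ 2 + ϖ * Q) := by
  by_contra hnu
  have hmem : -27 * (γ ^ 2 + 4 * ε) ^ 2 + ϖ * Q ∈ maximalIdeal R := hnu
  rw [← residue_eq_zero_iff] at hmem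
  have hϖ0 : residue R ϖ = 0 := (residue_eq_zero_iff _).mpr hϖ.not_isUnit
  have h3' : residue R 3 ≠ 0 := (residue_ne_zero_iff_isUnit _).mpr h3
  have h27 : (27 : ResidueField R) ≠ 0 := by
    rw [map_ofNat] at h3'
    rw [show (27 : ResidueField R) = 3 ^ 3 by norm_num]
    exact pow_ne_zero _ h3'
  simp only [map_add, map_mul, map_neg, map_pow, map_ofNat, hϖ0, zero_mul, add_zero, neg_mul,
    neg_eq_zero, mul_eq_zero, h27, false_or, pow_eq_zero_iff, ne_eq, OfNat.ofNat_ne_zero,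
    not_false_eq_true] at hmem
  exact hdisc hmem

end Discriminant

/-! ## §3 `exp (-12) < v(Δ)` for the normal forms at a place (`ℓ ≠ 3`) -/

section PlaceDiscriminant

variable {A : Type*} [CommRing A] [IsDedekindDomain A] {K : Type*} [Field K] [Algebra A K]
  [IsFractionRing A K] (v : HeightOneSpectrum A)

/-- `v(ϖⁿ · u) = exp (-n)` for an irreducible `ϖ` and a unit `u` of `𝒪_v`. [folklore] -/
theorem valued_pow_mul_eq_exp_neg {ϖ u : v.adicCompletionIntegers K} (hϖ : Irreducible ϖ)
    (hu : IsUnit u) (n : ℕ) :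
    Valued.v (((ϖ ^ n * u : v.adicCompletionIntegers K)) : v.adicCompletion K) =
      WithZero.exp (-(n : ℤ)) := by
  rw [Subring.coe_mul, Subring.coe_pow, Valuation.map_mul, Valuation.map_pow,
    valued_eq_exp_neg_one_of_irreducible v hϖ,
    HeightOneSpectrum.adicCompletionIntegers.isUnit_iff_valued_eq_one.mp hu, mul_one,
    ← WithZero.exp_nsmul]
  simp

/-- **Type `IV` normal form, `ℓ ≠ 3`: `exp (-12) < v(Δ)`** (`v(Δ) = exp (-4)`), hence (§1) every
integral model of it is minimal. [cite: SilvermanATAEC1994, IV.9.4 Step 5 (PDF p. 344)] -/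
theorem exp_neg_twelve_lt_valued_Δ_of_normalForm_IV (J : WeierstrassCurve (v.adicCompletionIntegers K))
    (h1 : J.a₁ ∈ maximalIdeal _) (h2 : J.a₂ ∈ maximalIdeal _) {ϖ γ ε : v.adicCompletionIntegers K}
    (hϖ : Irreducible ϖ) (hγ : J.a₃ = ϖ * γ) (h4 : J.a₄ ∈ maximalIdeal _ ^ 2) (hε : J.a₆ = ϖ ^ 2 * ε)
    (hdisc : residue _ γ ^ 2 + 4 * residue _ ε ≠ 0) (h3 : IsUnit (3 : v.adicCompletionIntegers K)) :
    WithZero.exp (-12 : ℤ) < Valued.v ((J.Δ : v.adicCompletionIntegers K) : v.adicCompletion K) := by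
  obtain ⟨Q, hQ⟩ := exists_Δ_eq_pow_four_mul_of_normalForm_IV J h1 h2 hϖ hγ h4 hε
  rw [hQ, valued_pow_mul_eq_exp_neg v hϖ (isUnit_discCofactor hϖ h3 hdisc Q) 4, WithZero.exp_lt_exp]
  norm_num

/-- **Type `IV*` normal form, `ℓ ≠ 3`: `exp (-12) < v(Δ)`** (`v(Δ) = exp (-8)`).
[cite: SilvermanATAEC1994, IV.9.4 Step 8 (PDF p. 346)] -/
theorem exp_neg_twelve_lt_valued_Δ_of_normalForm_IVstar
    (J : WeierstrassCurve (v.adicCompletionIntegers K))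
    (h1 : J.a₁ ∈ maximalIdeal _) (h2 : J.a₂ ∈ maximalIdeal _ ^ 2) {ϖ γ ε : v.adicCompletionIntegers K}
    (hϖ : Irreducible ϖ) (hγ : J.a₃ = ϖ ^ 2 * γ) (h4 : J.a₄ ∈ maximalIdeal _ ^ 3)
    (hε : J.a₆ = ϖ ^ 4 * ε) (hdisc : residue _ γ ^ 2 + 4 * residue _ ε ≠ 0)
    (h3 : IsUnit (3 : v.adicCompletionIntegers K)) :
    WithZero.exp (-12 : ℤ) < Valued.v ((J.Δ : v.adicCompletionIntegers K) : v.adicCompletion K) := by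
  obtain ⟨Q, hQ⟩ := exists_Δ_eq_pow_eight_mul_of_normalForm_IVstar J h1 h2 hϖ hγ h4 hε
  rw [hQ, valued_pow_mul_eq_exp_neg v hϖ (isUnit_discCofactor hϖ h3 hdisc Q) 8, WithZero.exp_lt_exp]
  norm_num

end PlaceDiscriminant

end TypeIVTwist

end Summit.BirchSwinnertonDyer.Rank1Residual.AdditivePotMult

end
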